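import Summits.QuantumAdvantage.QuantumAdvantage.Theorems.CubicForrelationNearExactIsExactCubicFormRadical

/-!
# Crux `CubicForrelation.NearExactIsExact` (stmt-QuantumAdvantage-14043) — DICKSON'S THEOREM, EXACT FORM, on any number of bits

Certificate seat `b2b-cforr-cert` (gen 41).  HONEST FRAMING: kernel-checked elementary counting (standard axioms, Mathlib + the tree's
bit-vector language only) — the generic tool "Dickson EXACTNESS" listed as still missing in the Lean roadmap for `E1280-even`
(HOME/b2b-cforr-cert-g40/LEAN-PLAN-E1280-EVEN.md §4–5).  The cell lemmas of the light-cell analysis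
(HOME/b2b-cforr-cert-g39/E1280-HANDPROOFS.md App. A: "a quadratic on `k` bits whose alternating part has rank `2h ≥ 2` has weight
`2^{k−1}` or `2^{k−1} ± 2^{k−1−h}`; rank `0`: weight `0`, `2^{k−1}` or `2^k`") need the EXACT weight, not only the bound
`|2ⁿ − 2#q| ≤ 2^{n−h}` of …CubicFormDickson (`tcd_frame_card`).  Input format: the base-point free second difference `B` of `q`
(…CubicFormHyperplane `tch_second_const` for `deg q ≤ 2`) and a MAXIMAL frame of `B` (…CubicFormSymplectic `tcs_frame_exists`, or the
frame of …CubicFormQuadratic `tcq_dickson` specialised at the base point `0`); with …CubicFormRadical the `h` is `rank/2`.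
Nothing about `θ₁₂`; NOT summit progress.

* `tce_dickson_exact`: `h ≤ n` and `2·#{q = 1} ∈ {2ⁿ − 2^{n−h}, 2ⁿ, 2ⁿ + 2^{n−h}}`.

References: L. E. Dickson, *Linear Groups* (1901) Ch. VIII; F. J. MacWilliams, N. J. A. Sloane (1977) Ch. 15 §2 Thm 5.
Axioms: the standard three.
-/

set_option linter.dupNamespace false -- D-0017: single-problem summit ⇒ `QuantumAdvantage.QuantumAdvantage` by design

namespace Summit.QuantumAdvantage.QuantumAdvantage.Theorems.CubicForrelation.NearExactIsExact

open Finset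
open Literature.Computability.QuantumComplexity.BuzetChailloux (bxor zeroVec bxor_comm bxor_self bxor_zeroVec zeroVec_bxor
  bxor_bxor_cancel_left)

variable {n : ℕ}

/-- **Dickson's theorem, exact form.**  Let `B` be the base-point free second difference of `q : 𝔽₂ⁿ → Bool`
(`q(x) ⊕ q(x⊕w) ⊕ q(x⊕v) ⊕ q(x⊕v⊕w) = B(v,w)` for all `x`, i.e. `deg q ≤ 2`), and `(bᵢ, cᵢ)_{i<h}` a MAXIMAL frame of `B`.  Then
`h ≤ n` and `2·#{q = 1}` is `2ⁿ − 2^{n−h}`, `2ⁿ`, or `2ⁿ + 2^{n−h}`.  Proof: with `Dᵢ = q ⊕ q(·⊕bᵢ)` and `Z = {Dᵢ = 0 ∀ i}`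
(`#Z = 2^{n−h}`, translations by `cₖ`), `q` is balanced on each layer `{D₀ = ⋯ = D_{k−1} = 0, D_k = 1}` (translation by `b_k` flips
`q` there), and on `Z` — a coset of `V = {B(·,bᵢ) = 0 ∀ i}`, on which `B ≡ 0` by maximality — `q` is `⊕`-affine, hence `0`, balanced or
`1`. [cite: MacWilliamsSloane1977, Ch. 15 §2 Thm 5] -/
theorem tce_dickson_exact (q : (Fin n → Bool) → Bool) (B : (Fin n → Bool) → (Fin n → Bool) → Bool)
    (hB : ∀ v w x, ((q x ^^ q (bxor x w)) ^^ (q (bxor x v) ^^ q (bxor (bxor x v) w))) = B v w)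
    (h : ℕ) (b c : Fin h → (Fin n → Bool))
    (hbc : ∀ i, B (b i) (c i) = true) (hbc' : ∀ i j, i ≠ j → B (b i) (c j) = false) (hbb : ∀ i j, B (b i) (b j) = false)
    (hmax : ∀ x y, (∀ i, B x (b i) = false) → (∀ i, B x (c i) = false) → (∀ i, B y (b i) = false) → (∀ i, B y (c i) = false) →
      B x y = false) :
    h ≤ n ∧ (2 * #(univ.filter fun x : Fin n → Bool => q x = true) + 2 ^ (n - h) = 2 ^ n ∨
      2 * #(univ.filter fun x : Fin n → Bool => q x = true) = 2 ^ n ∨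
      2 * #(univ.filter fun x : Fin n → Bool => q x = true) = 2 ^ n + 2 ^ (n - h)) := by
  classical
  -- the form is symmetric and additive
  have hsymm : ∀ v w, B v w = B w v := by
    intro v w
    rw [← hB v w zeroVec, ← hB w v zeroVec, iw_bxor_assoc, iw_bxor_assoc, bxor_comm v w]
    cases q zeroVec <;> cases q (bxor zeroVec w) <;> cases q (bxor zeroVec v) <;> cases q (bxor zeroVec (bxor w v)) <;> rfl
  have hadd : ∀ u v w, B (bxor u v) w = (B u w ^^ B v w) := by
    intro u v w
    rw [← hB (bxor u v) w zeroVec, ← hB u w zeroVec, ← hB v w u]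
    simp only [zeroVec_bxor]
    cases q zeroVec <;> cases q w <;> cases q u <;> cases q (bxor u w) <;> cases q (bxor u v) <;>
      cases q (bxor (bxor u v) w) <;> rfl
  -- first differences along the `bᵢ`
  set D : Fin h → (Fin n → Bool) → Bool := fun i x => q x ^^ q (bxor x (b i)) with hDdef
  have hDshift : ∀ i x t, D i (bxor x t) = (D i x ^^ B t (b i)) := by
    intro i x t
    have e := hB t (b i) x
    rw [hDdef]; simp only
    rw [← e]
    cases q x <;> cases q (bxor x (b i)) <;> cases q (bxor x t) <;> cases q (bxor (bxor x t) (b i)) <;> rfl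
  set Z : Finset (Fin n → Bool) := univ.filter fun x => ∀ i, D i x = false with hZdef
  -- `#Z · 2^h = 2^n`
  have hZcard : #Z * 2 ^ h = 2 ^ n := by
    have e := tce_iter_half (univ : Finset (Fin n → Bool)) D c (fun k x _ => mem_univ _)
      (fun k x _ => by rw [hDshift, hsymm, hbc k, Bool.xor_true])
      (fun k i hik x _ => by rw [hDshift, hsymm, hbc' i k hik, Bool.xor_false])
    rw [card_univ, Fintype.card_fun, Fintype.card_bool, Fintype.card_fin] at e
    rw [hZdef]; exact e
  have hZpos : 0 < #Z := by
    rcases Nat.eq_zero_or_pos #Z with h0 | hp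
    · rw [h0, zero_mul] at hZcard; exact absurd hZcard (by positivity)
    · exact hp
  have hhn : h ≤ n := by
    by_contra hlt
    rw [not_le] at hlt
    have h1 : 2 ^ n < 2 ^ h := Nat.pow_lt_pow_right (by norm_num) hlt
    have h2 : 2 ^ h ≤ #Z * 2 ^ h := Nat.le_mul_of_pos_left _ hZpos
    omega
  have hZcard' : #Z = 2 ^ (n - h) := by
    have hnh : 2 ^ (n - h) * 2 ^ h = 2 ^ n := by rw [← pow_add, Nat.sub_add_cancel hhn]
    exact Nat.eq_of_mul_eq_mul_right (by positivity) (hZcard.trans hnh.symm)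
  -- `q` is balanced off `Z`: `2 · #{q = 1, x ∉ Z_k} + #Z_k = 2^n` along the filtration
  set Zk : ℕ → Finset (Fin n → Bool) := fun k => univ.filter fun x => ∀ i : Fin h, i.val < k → D i x = false with hZkdef
  have hoff : ∀ k, k ≤ h → 2 * #(univ.filter fun x : Fin n → Bool => q x = true ∧ x ∉ Zk k) + #(Zk k) = 2 ^ n := by
    intro k
    induction k with
    | zero =>
      intro _
      have hZ0 : Zk 0 = univ := by rw [hZkdef]; ext x; simp
      have hE : (univ.filter fun x : Fin n → Bool => q x = true ∧ x ∉ Zk 0) = ∅ := by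
        rw [hZ0]; ext x; simp
      rw [hE, hZ0, card_empty, mul_zero, zero_add, card_univ, Fintype.card_fun, Fintype.card_bool, Fintype.card_fin]
    | succ k ih =>
      intro hk
      have ihk := ih (Nat.le_of_succ_le hk)
      have hkh : k < h := hk
      set i₀ : Fin h := ⟨k, hkh⟩ with hi₀
      -- the layer `M = Z_k ∩ {D_{i₀} = 1}` and `Z_{k+1} = Z_k ∩ {D_{i₀} = 0}`
      have hZsucc : Zk (k + 1) = (Zk k).filter fun x => D i₀ x = false := by
        rw [hZkdef]; ext x
        simp only [mem_filter, mem_univ, true_and]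
        constructor
        · intro hx
          exact ⟨fun i hi => hx i (Nat.lt_succ_of_lt hi), hx i₀ (by rw [hi₀]; exact Nat.lt_succ_self k)⟩
        · rintro ⟨hx, h0⟩ i hi
          rcases Nat.lt_succ_iff_lt_or_eq.1 hi with hlt | heq
          · exact hx i hlt
          · have : i = i₀ := Fin.ext (by rw [hi₀]; exact heq)
            rw [this]; exact h0
      -- translation by `b_{i₀}` preserves the layer and flips `q` on it
      have hpres : ∀ x ∈ (Zk k).filter (fun x => D i₀ x = true), bxor x (b i₀) ∈ (Zk k).filter fun x => D i₀ x = true := by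
        intro x hx
        obtain ⟨hxZ, hxD⟩ := mem_filter.1 hx
        have hxZ' := (mem_filter.1 hxZ).2
        refine mem_filter.2 ⟨mem_filter.2 ⟨mem_univ _, fun i hi => ?_⟩, ?_⟩
        · rw [hDshift, hbb, Bool.xor_false]; exact hxZ' i hi
        · rw [hDshift, hbb, Bool.xor_false]; exact hxD
      have hflipq : ∀ x ∈ (Zk k).filter (fun x => D i₀ x = true), q (bxor x (b i₀)) = !q x := by
        intro x hx
        have hxD := (mem_filter.1 hx).2
        rw [hDdef] at hxD; simp only at hxD
        revert hxD
        cases q x <;> cases q (bxor x (b i₀)) <;> simp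
      obtain ⟨hM1, -⟩ := tce_half ((Zk k).filter fun x => D i₀ x = true) (b i₀) q hpres hflipq
      -- bookkeeping
      have hsplitZ : #((Zk k).filter fun x => D i₀ x = true) + #(Zk (k + 1)) = #(Zk k) := by
        rw [hZsucc]
        have e := card_filter_add_card_filter_not (s := Zk k) (fun x => D i₀ x = true)
        have hneg : ((Zk k).filter fun x => ¬ D i₀ x = true) = ((Zk k).filter fun x => D i₀ x = false) :=
          filter_congr fun x _ => by cases D i₀ x <;> simp
        rw [hneg] at e; exact e
      have hsplitE : #(univ.filter fun x : Fin n → Bool => q x = true ∧ x ∉ Zk (k + 1)) =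
          #(univ.filter fun x : Fin n → Bool => q x = true ∧ x ∉ Zk k) +
            #(((Zk k).filter fun x => D i₀ x = true).filter fun x => q x = true) := by
        rw [← card_union_of_disjoint]
        · congr 1
          ext x
          simp only [mem_filter, mem_univ, true_and, mem_union, hZsucc, not_and, Bool.not_eq_false]
          constructor
          · rintro ⟨hq1, hx⟩
            by_cases hxk : x ∈ Zk k
            · exact Or.inr ⟨⟨hxk, hx hxk⟩, hq1⟩
            · exact Or.inl ⟨hq1, hxk⟩
          · rintro (⟨hq1, hxk⟩ | ⟨⟨hxk, hD1⟩, hq1⟩)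
            · exact ⟨hq1, fun h' => absurd h' hxk⟩
            · exact ⟨hq1, fun _ => hD1⟩
        · rw [disjoint_left]
          intro x hx hx'
          exact (mem_filter.1 hx).2.2 (mem_filter.1 (mem_filter.1 hx').1).1
      omega
  have hZkh : Zk h = Z := by
    rw [hZkdef, hZdef]; ext x
    simp only [mem_filter, mem_univ, true_and]
    exact ⟨fun hx i => hx i i.isLt, fun hx i _ => hx i⟩
  have hoffh := hoff h le_rfl
  rw [hZkh] at hoffh
  -- on `Z`, `q` is `⊕`-affine: `Z` is closed under `x ⊕ y ⊕ z` and `B` vanishes on differences of its elements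
  have hBZ : ∀ y ∈ Z, ∀ i, B y (b i) = D i zeroVec := by
    intro y hy i
    have e := hDshift i zeroVec y
    rw [zeroVec_bxor, (mem_filter.1 hy).2 i] at e
    revert e; cases B y (b i) <;> cases D i zeroVec <;> simp
  have hVdiff : ∀ y ∈ Z, ∀ z ∈ Z, ∀ i, B (bxor y z) (b i) = false := by
    intro y hy z hz i
    rw [hadd, hBZ y hy i, hBZ z hz i, Bool.xor_self]
  have hZ3 : ∀ x ∈ Z, ∀ y ∈ Z, ∀ z ∈ Z, bxor x (bxor y z) ∈ Z := by
    intro x hx y hy z hz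
    refine mem_filter.2 ⟨mem_univ _, fun i => ?_⟩
    rw [hDshift, hVdiff y hy z hz i, Bool.xor_false]
    exact (mem_filter.1 hx).2 i
  have hq3 : ∀ x ∈ Z, ∀ y ∈ Z, ∀ z ∈ Z, q (bxor x (bxor y z)) = ((q x ^^ q y) ^^ q z) := by
    intro x hx y hy z hz
    have e := hB (bxor x y) (bxor x z) x
    rw [bxor_bxor_cancel_left, bxor_bxor_cancel_left] at e
    have e3 : bxor y (bxor x z) = bxor x (bxor y z) := by
      rw [← iw_bxor_assoc, bxor_comm y x, iw_bxor_assoc]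
    rw [e3] at e
    have hv := tce_form_vanish B hsymm hadd h b c hbc hbc' hbb hmax (bxor x y) (bxor x z) (hVdiff x hx y hy) (hVdiff x hx z hz)
    rw [hv] at e
    revert e
    cases q x <;> cases q y <;> cases q z <;> cases q (bxor x (bxor y z)) <;> simp
  have htri := tce_affine_dichotomy Z q hZ3 hq3
  -- assemble
  have hsplit : #(univ.filter fun x : Fin n → Bool => q x = true) =
      #(univ.filter fun x : Fin n → Bool => q x = true ∧ x ∉ Z) + #(Z.filter fun x => q x = true) := by
    rw [← card_union_of_disjoint]
    · congr 1
      ext x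
      simp only [mem_filter, mem_univ, true_and, mem_union]
      constructor
      · intro hq1
        by_cases hxZ : x ∈ Z
        · exact Or.inr ⟨hxZ, hq1⟩
        · exact Or.inl ⟨hq1, hxZ⟩
      · rintro (⟨hq1, _⟩ | ⟨_, hq1⟩) <;> exact hq1
    · rw [disjoint_left]
      intro x hx hx'
      exact (mem_filter.1 hx).2.2 (mem_filter.1 hx').1
  refine ⟨hhn, ?_⟩
  rw [hZcard'] at hoffh htri
  rcases htri with h0 | h1 | h2
  · left; omega
  · right; left; omega
  · right; right; omega

end Summit.QuantumAdvantage.QuantumAdvantage.Theorems.CubicForrelation.NearExactIsExact
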